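import Mathlib
import HarnessLib

/-!
# LINE (A) `product_plus_one` (crux `MatrixDescartes`, stmt-ValiantsHypothesis-18050, V1) — W-CB accounting: the FAR-MERGING LEMMA
# «knees of one rate, all at distance ≥ ln 2/κ beyond the same side of a point, have a strictly log-concave aggregate there»

Owner memo `pub/ideators/val-idea-25/NOTE-idea25g3-18050-LINEA-AB-reduction.md` §26.5 (val-idea-25 g5: the summable form of the floor needs a
MERGING LEMMA (M) «same-rate fast knees all centred ≥ δ/κ outside the window act on it as ONE knee») and `pub/val-lit/lmr/NOTE-p8g17-18050-pure-2N-law.md`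
§8 (val-lit-p8 g17).  In θ-currency (`θ = x·d/dx`) a knee row of rate `κ = n+1` contributes `B = w·q/(1+q)²`, `q = λ·x^κ`, with
`θB = −κ·T·B`, `T = (q−1)/(q+1)`, and `θ²B = κ²·B·(3T²−1)/2`.  For a family of such knees of ONE rate the aggregate `A = ΣB_j` has
`A·θ²A − (θA)² = κ²·[(3/2)·Z·ΣB_jT_j² − ½Z² − P²]` (`Z = ΣB_j`, `P = ΣB_jT_j`), and if every `T_j ∈ [1/3, 1)` — i.e. `λ_j x^κ ≥ 2`, the knee centre
lies at distance `≥ ln 2/κ` to the LEFT of the point in `u = log x` — then `ΣB_j(1−T_j)(T_j − 1/3) ≥ 0` gives `ΣB_jT_j² ≤ (4/3)P − Z/3`, whence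
`A·θ²A − (θA)² ≤ −κ²(Z − P)² < 0`: the cluster is STRICTLY LOG-CONCAVE there (mirror: all `λ_j x^κ ≤ 1/2`).  The margin `ln 2/κ` is sharp.

* §1 `sum_mul_sum_lt_sq_of_third_le` — the finset inequality (any index type, weights `B_j > 0`, `T_j ∈ [1/3,1)`), and its mirror;
* §2 the explicit one-rate knee aggregate: θ-tower `hasDerivAt_kneeAggregate`, `hasDerivAt_kneeAggregate_theta` and ★ `kneeAggregate_logConcave_of_far`
  (`∀ j, 2 ≤ λ_j x^κ ⇒ A·A₂ < A₁²`), `…_of_near` (`∀ j, λ_j x^κ ≤ 1/2`);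
* §3 ★ `no_three_zeros_of_logConcave_sub_logConvex` — abstract engine: on a window of `(0,∞)`, `A, G > 0` with θ-towers, `A·A₂ < A₁²` (strictly
  log-concave) and `G₁² ≤ G·G₂` (log-convex) ⇒ `A − G` has no three zeros (Rolle twice on `log A − log G`).  With §2 and a log-convex background
  (poles of any rate, clouds: ✓ `…OneBump`, ✓ `…LogConvexAlgebra`) a window whose same-rate knees all sit ≥ ln 2/κ beyond one of its ends carries
  at most TWO zeros of `W(∏f)` — the cluster counts as one knee.

Honest framing: a merging/accounting lemma and an N = 1-type engine; nothing here proves `WronskianBudgetK3` / `OneChangeFloorK3` / the stubs /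
18050 / `MatrixDescartes`; `VP ≠ VNP` is NOT proved.  No definitions, no named facts; Mathlib only.
-/

set_option linter.dupNamespace false

namespace Summit.ValiantsHypothesis.ValiantsHypothesis.Theorems.LacunarySymmetroidMatrixDescartes

namespace ProductPlusOne

open Set Finset
open scoped BigOperators Topology

/-! ### §1 The finset inequality -/

/-- **Bhatia–Davis one-liner.**  For weights `B_j > 0` and `T_j ∈ [1/3, 1)`:
`(Σ B_j)·(Σ B_j(3T_j²−1)/2) < (Σ B_jT_j)²` — indeed `Σ B_j(1−T_j)(T_j−1/3) ≥ 0` gives `ΣB_jT_j² ≤ (4/3)ΣB_jT_j − (ΣB_j)/3`, so the left side is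
`≤ 2ZP − Z² = P² − (Z−P)²` with `Z − P = ΣB_j(1−T_j) > 0`. [this file's lemma] -/
theorem sum_mul_sum_lt_sq_of_third_le {ι : Type*} (s : Finset ι) (hs : s.Nonempty) (B T : ι → ℝ)
    (hB : ∀ j ∈ s, 0 < B j) (hT : ∀ j ∈ s, 1 / 3 ≤ T j) (hT1 : ∀ j ∈ s, T j < 1) :
    (∑ j ∈ s, B j) * (∑ j ∈ s, B j * ((3 * T j ^ 2 - 1) / 2)) < (∑ j ∈ s, B j * T j) ^ 2 := by
  have h1 : 0 ≤ ∑ j ∈ s, B j * ((1 - T j) * (T j - 1 / 3)) :=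
    sum_nonneg fun j hj => mul_nonneg (hB j hj).le (mul_nonneg (by linarith [hT1 j hj]) (by linarith [hT j hj]))
  have h2 : 0 < ∑ j ∈ s, B j * (1 - T j) :=
    sum_pos (fun j hj => mul_pos (hB j hj) (by linarith [hT1 j hj])) hs
  have hZ : 0 < ∑ j ∈ s, B j := sum_pos hB hs
  -- linear rewriting of the three sums
  have e1 : ∑ j ∈ s, B j * ((1 - T j) * (T j - 1 / 3)) =
      (4 / 3) * (∑ j ∈ s, B j * T j) - (1 / 3) * (∑ j ∈ s, B j) - ∑ j ∈ s, B j * T j ^ 2 := by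
    rw [mul_sum, mul_sum, ← sum_sub_distrib, ← sum_sub_distrib]
    exact sum_congr rfl fun j _ => by ring
  have e2 : ∑ j ∈ s, B j * ((3 * T j ^ 2 - 1) / 2) = (3 / 2) * (∑ j ∈ s, B j * T j ^ 2) - (1 / 2) * ∑ j ∈ s, B j := by
    rw [mul_sum, mul_sum, ← sum_sub_distrib]
    exact sum_congr rfl fun j _ => by ring
  have e3 : ∑ j ∈ s, B j * (1 - T j) = (∑ j ∈ s, B j) - ∑ j ∈ s, B j * T j := by
    rw [← sum_sub_distrib]
    exact sum_congr rfl fun j _ => by ring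
  set Z := ∑ j ∈ s, B j
  set P := ∑ j ∈ s, B j * T j
  set Q := ∑ j ∈ s, B j * T j ^ 2
  rw [e1] at h1
  rw [e3] at h2
  rw [e2]
  nlinarith [mul_nonneg hZ.le h1, sq_nonneg (Z - P), h2]

/-- Mirror of `sum_mul_sum_lt_sq_of_third_le`: the same for `T_j ∈ (−1, −1/3]`. [this file's lemma] -/
theorem sum_mul_sum_lt_sq_of_le_neg_third {ι : Type*} (s : Finset ι) (hs : s.Nonempty) (B T : ι → ℝ)
    (hB : ∀ j ∈ s, 0 < B j) (hT : ∀ j ∈ s, T j ≤ -(1 / 3)) (hT1 : ∀ j ∈ s, -1 < T j) :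
    (∑ j ∈ s, B j) * (∑ j ∈ s, B j * ((3 * T j ^ 2 - 1) / 2)) < (∑ j ∈ s, B j * T j) ^ 2 := by
  have h := sum_mul_sum_lt_sq_of_third_le s hs B (fun j => -T j) hB
    (fun j hj => by linarith [hT j hj]) (fun j hj => by linarith [hT1 j hj])
  have e : ∑ j ∈ s, B j * -T j = -∑ j ∈ s, B j * T j := by rw [← sum_neg_distrib]; exact sum_congr rfl fun j _ => by ring
  simpa [neg_sq, e] using h

/-! ### §2 The explicit one-rate knee aggregate -/

/-- θ-derivative of one knee term `q/(1+q)²`, `q = λx^{n+1}`: `θ(q/(1+q)²) = −(n+1)·T·q/(1+q)²` with `T = (q−1)/(q+1)`, written as an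
`x`-derivative. [this file's lemma] -/
theorem hasDerivAt_kneeTerm (n : ℕ) {lam x : ℝ} (hlam : 0 < lam) (hx : 0 < x) :
    HasDerivAt (fun x : ℝ => lam * x ^ (n + 1) / (1 + lam * x ^ (n + 1)) ^ 2)
      ((-((n : ℝ) + 1) * ((lam * x ^ (n + 1) - 1) / (lam * x ^ (n + 1) + 1))
        * (lam * x ^ (n + 1) / (1 + lam * x ^ (n + 1)) ^ 2)) / x) x := by
  have hq : 0 < lam * x ^ (n + 1) := mul_pos hlam (pow_pos hx _)
  have h1 : (1 + lam * x ^ (n + 1)) ≠ 0 := by linarith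
  have h1' : (lam * x ^ (n + 1) + 1) ≠ 0 := by linarith
  have hqd : HasDerivAt (fun x : ℝ => lam * x ^ (n + 1)) (lam * (((n + 1 : ℕ) : ℝ) * x ^ n)) x :=
    (hasDerivAt_pow (n + 1) x).const_mul lam
  have hden : HasDerivAt (fun x : ℝ => (1 + lam * x ^ (n + 1)) ^ 2)
      (2 * (1 + lam * x ^ (n + 1)) * (lam * (((n + 1 : ℕ) : ℝ) * x ^ n))) x := by
    have := (hqd.const_add 1).pow 2
    refine this.congr_deriv ?_
    push_cast
    ring
  refine (hqd.div hden (pow_ne_zero _ h1)).congr_deriv ?_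
  push_cast
  field_simp
  ring

/-- θ-derivative of the tilted knee term `T·q/(1+q)²`: `θ(T·q/(1+q)²) = (n+1)·(1 − 3T²)/2 · q/(1+q)²`. [this file's lemma] -/
theorem hasDerivAt_kneeTerm_theta (n : ℕ) {lam x : ℝ} (hlam : 0 < lam) (hx : 0 < x) :
    HasDerivAt (fun x : ℝ => ((lam * x ^ (n + 1) - 1) / (lam * x ^ (n + 1) + 1))
        * (lam * x ^ (n + 1) / (1 + lam * x ^ (n + 1)) ^ 2))
      ((((n : ℝ) + 1) * ((1 - 3 * ((lam * x ^ (n + 1) - 1) / (lam * x ^ (n + 1) + 1)) ^ 2) / 2)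
        * (lam * x ^ (n + 1) / (1 + lam * x ^ (n + 1)) ^ 2)) / x) x := by
  have hq : 0 < lam * x ^ (n + 1) := mul_pos hlam (pow_pos hx _)
  have h1 : (1 + lam * x ^ (n + 1)) ≠ 0 := by linarith
  have h1' : (lam * x ^ (n + 1) + 1) ≠ 0 := by linarith
  have hqd : HasDerivAt (fun x : ℝ => lam * x ^ (n + 1)) (lam * (((n + 1 : ℕ) : ℝ) * x ^ n)) x :=
    (hasDerivAt_pow (n + 1) x).const_mul lam
  have hT : HasDerivAt (fun x : ℝ => (lam * x ^ (n + 1) - 1) / (lam * x ^ (n + 1) + 1))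
      (((lam * (((n + 1 : ℕ) : ℝ) * x ^ n)) * (lam * x ^ (n + 1) + 1)
        - (lam * x ^ (n + 1) - 1) * (lam * (((n + 1 : ℕ) : ℝ) * x ^ n))) / (lam * x ^ (n + 1) + 1) ^ 2) x :=
    (hqd.sub_const 1).div (hqd.add_const 1) h1'
  refine (hT.mul (hasDerivAt_kneeTerm n hlam hx)).congr_deriv ?_
  push_cast
  field_simp
  ring

/-- ★ **FAR-MERGING: the one-rate knee aggregate is strictly log-concave wherever every knee has `λ_j x^{n+1} ≥ 2`** (centres at distance
`≥ ln 2/(n+1)` to the left of the point in `u = log x`).  With `B_j := w_j·q_j/(1+q_j)²`, `T_j := (q_j−1)/(q_j+1)`, `A := ΣB_j`,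
`A₁ := Σ(−(n+1)T_j)B_j` (`= θA`) and `A₂ := Σ (n+1)²(3T_j²−1)/2·B_j` (`= θ²A`): `A·A₂ < A₁²`. [this file's theorem] -/
theorem kneeAggregate_logConcave_of_far (n : ℕ) {ι : Type*} (s : Finset ι) (hs : s.Nonempty) (w lam : ι → ℝ)
    (hw : ∀ j ∈ s, 0 < w j) (hlam : ∀ j ∈ s, 0 < lam j) {x : ℝ} (hx : 0 < x) (hfar : ∀ j ∈ s, 2 ≤ lam j * x ^ (n + 1)) :
    (∑ j ∈ s, w j * (lam j * x ^ (n + 1) / (1 + lam j * x ^ (n + 1)) ^ 2)) *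
      (∑ j ∈ s, ((n : ℝ) + 1) ^ 2 * ((3 * ((lam j * x ^ (n + 1) - 1) / (lam j * x ^ (n + 1) + 1)) ^ 2 - 1) / 2)
        * (w j * (lam j * x ^ (n + 1) / (1 + lam j * x ^ (n + 1)) ^ 2)))
    < (∑ j ∈ s, -((n : ℝ) + 1) * ((lam j * x ^ (n + 1) - 1) / (lam j * x ^ (n + 1) + 1))
        * (w j * (lam j * x ^ (n + 1) / (1 + lam j * x ^ (n + 1)) ^ 2))) ^ 2 := by
  set B : ι → ℝ := fun j => w j * (lam j * x ^ (n + 1) / (1 + lam j * x ^ (n + 1)) ^ 2) with hBdef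
  set T : ι → ℝ := fun j => (lam j * x ^ (n + 1) - 1) / (lam j * x ^ (n + 1) + 1) with hTdef
  have hB : ∀ j ∈ s, 0 < B j := fun j hj =>
    mul_pos (hw j hj) (div_pos (mul_pos (hlam j hj) (pow_pos hx _)) (by nlinarith [mul_pos (hlam j hj) (pow_pos hx (n + 1))]))
  have hT : ∀ j ∈ s, 1 / 3 ≤ T j := by
    intro j hj
    have hq : 2 ≤ lam j * x ^ (n + 1) := hfar j hj
    rw [hTdef]
    rw [le_div_iff₀ (by linarith)]
    linarith
  have hT1 : ∀ j ∈ s, T j < 1 := by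
    intro j hj
    have hq : 0 < lam j * x ^ (n + 1) := mul_pos (hlam j hj) (pow_pos hx _)
    rw [hTdef, div_lt_one (by linarith)]
    linarith
  have key := sum_mul_sum_lt_sq_of_third_le s hs B T hB hT hT1
  have eA₂ : ∑ j ∈ s, ((n : ℝ) + 1) ^ 2 * ((3 * T j ^ 2 - 1) / 2) * B j =
      ((n : ℝ) + 1) ^ 2 * ∑ j ∈ s, B j * ((3 * T j ^ 2 - 1) / 2) := by
    rw [mul_sum]; exact sum_congr rfl fun j _ => by ring
  have eA₁ : ∑ j ∈ s, -((n : ℝ) + 1) * T j * B j = -((n : ℝ) + 1) * ∑ j ∈ s, B j * T j := by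
    rw [mul_sum]; exact sum_congr rfl fun j _ => by ring
  have hk : 0 < ((n : ℝ) + 1) ^ 2 := by positivity
  show (∑ j ∈ s, B j) * (∑ j ∈ s, ((n : ℝ) + 1) ^ 2 * ((3 * T j ^ 2 - 1) / 2) * B j) <
    (∑ j ∈ s, -((n : ℝ) + 1) * T j * B j) ^ 2
  rw [eA₂, eA₁]
  nlinarith [mul_lt_mul_of_pos_left key hk]

/-- Mirror: strictly log-concave wherever every knee has `λ_j x^{n+1} ≤ 1/2` (centres ≥ ln 2/(n+1) to the RIGHT). [this file's theorem] -/
theorem kneeAggregate_logConcave_of_near (n : ℕ) {ι : Type*} (s : Finset ι) (hs : s.Nonempty) (w lam : ι → ℝ)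
    (hw : ∀ j ∈ s, 0 < w j) (hlam : ∀ j ∈ s, 0 < lam j) {x : ℝ} (hx : 0 < x) (hnear : ∀ j ∈ s, lam j * x ^ (n + 1) ≤ 1 / 2) :
    (∑ j ∈ s, w j * (lam j * x ^ (n + 1) / (1 + lam j * x ^ (n + 1)) ^ 2)) *
      (∑ j ∈ s, ((n : ℝ) + 1) ^ 2 * ((3 * ((lam j * x ^ (n + 1) - 1) / (lam j * x ^ (n + 1) + 1)) ^ 2 - 1) / 2)
        * (w j * (lam j * x ^ (n + 1) / (1 + lam j * x ^ (n + 1)) ^ 2)))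
    < (∑ j ∈ s, -((n : ℝ) + 1) * ((lam j * x ^ (n + 1) - 1) / (lam j * x ^ (n + 1) + 1))
        * (w j * (lam j * x ^ (n + 1) / (1 + lam j * x ^ (n + 1)) ^ 2))) ^ 2 := by
  set B : ι → ℝ := fun j => w j * (lam j * x ^ (n + 1) / (1 + lam j * x ^ (n + 1)) ^ 2) with hBdef
  set T : ι → ℝ := fun j => (lam j * x ^ (n + 1) - 1) / (lam j * x ^ (n + 1) + 1) with hTdef
  have hB : ∀ j ∈ s, 0 < B j := fun j hj =>
    mul_pos (hw j hj) (div_pos (mul_pos (hlam j hj) (pow_pos hx _)) (by nlinarith [mul_pos (hlam j hj) (pow_pos hx (n + 1))]))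
  have hT : ∀ j ∈ s, T j ≤ -(1 / 3) := by
    intro j hj
    have hq : lam j * x ^ (n + 1) ≤ 1 / 2 := hnear j hj
    have hq0 : 0 < lam j * x ^ (n + 1) := mul_pos (hlam j hj) (pow_pos hx _)
    rw [hTdef, div_le_iff₀ (by linarith)]
    linarith
  have hT1 : ∀ j ∈ s, -1 < T j := by
    intro j hj
    have hq : 0 < lam j * x ^ (n + 1) := mul_pos (hlam j hj) (pow_pos hx _)
    rw [hTdef, lt_div_iff₀ (by linarith)]
    linarith
  have key := sum_mul_sum_lt_sq_of_le_neg_third s hs B T hB hT hT1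
  have eA₂ : ∑ j ∈ s, ((n : ℝ) + 1) ^ 2 * ((3 * T j ^ 2 - 1) / 2) * B j =
      ((n : ℝ) + 1) ^ 2 * ∑ j ∈ s, B j * ((3 * T j ^ 2 - 1) / 2) := by
    rw [mul_sum]; exact sum_congr rfl fun j _ => by ring
  have eA₁ : ∑ j ∈ s, -((n : ℝ) + 1) * T j * B j = -((n : ℝ) + 1) * ∑ j ∈ s, B j * T j := by
    rw [mul_sum]; exact sum_congr rfl fun j _ => by ring
  have hk : 0 < ((n : ℝ) + 1) ^ 2 := by positivity
  show (∑ j ∈ s, B j) * (∑ j ∈ s, ((n : ℝ) + 1) ^ 2 * ((3 * T j ^ 2 - 1) / 2) * B j) <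
    (∑ j ∈ s, -((n : ℝ) + 1) * T j * B j) ^ 2
  rw [eA₂, eA₁]
  nlinarith [mul_lt_mul_of_pos_left key hk]

/-! ### §3 The engine: strictly log-concave minus log-convex has no three zeros -/

/-- ★ **ENGINE.**  On a window `(u,v) ⊂ (0,∞)` let `A > 0` and `G > 0` carry θ-towers `HasDerivAt A (A₁ x/x) x`, `HasDerivAt A₁ (A₂ x/x) x`
(and likewise for `G`), with `A·A₂ < A₁²` (strictly log-concave hump) and `G₁² ≤ G·G₂` (log-convex background).  Then `A − G` does not
vanish at three points of the window (Rolle twice on `log A − log G`, whose θ²-derivative is `(A A₂ − A₁²)/A² − (G G₂ − G₁²)/G² < 0`).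
[this file's theorem] -/
theorem no_three_zeros_of_logConcave_sub_logConvex {A A₁ A₂ G G₁ G₂ : ℝ → ℝ} {u v : ℝ} (hu : 0 ≤ u)
    (hA : ∀ x ∈ Ioo u v, HasDerivAt A (A₁ x / x) x) (hA₁ : ∀ x ∈ Ioo u v, HasDerivAt A₁ (A₂ x / x) x)
    (hG : ∀ x ∈ Ioo u v, HasDerivAt G (G₁ x / x) x) (hG₁ : ∀ x ∈ Ioo u v, HasDerivAt G₁ (G₂ x / x) x)
    (hApos : ∀ x ∈ Ioo u v, 0 < A x) (hGpos : ∀ x ∈ Ioo u v, 0 < G x)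
    (hlc : ∀ x ∈ Ioo u v, A x * A₂ x < A₁ x ^ 2) (hlx : ∀ x ∈ Ioo u v, G₁ x ^ 2 ≤ G x * G₂ x)
    {x₁ x₂ x₃ : ℝ} (h₁ : x₁ ∈ Ioo u v) (h₃ : x₃ ∈ Ioo u v) (h12 : x₁ < x₂) (h23 : x₂ < x₃)
    (hz₁ : A x₁ = G x₁) (hz₂ : A x₂ = G x₂) (hz₃ : A x₃ = G x₃) : False := by
  have h₂ : x₂ ∈ Ioo u v := ⟨h₁.1.trans h12, h23.trans h₃.2⟩
  have hpos : ∀ x ∈ Ioo u v, 0 < x := fun x hx => hu.trans_lt hx.1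
  have hIc : (Ioo u v).OrdConnected := ordConnected_Ioo
  -- `h = log A − log G` and its θ-derivative `h₁ = A₁/A − G₁/G`
  set h : ℝ → ℝ := fun x => Real.log (A x) - Real.log (G x) with hhdef
  set hθ : ℝ → ℝ := fun x => A₁ x / A x - G₁ x / G x with hhθdef
  have hh : ∀ x ∈ Ioo u v, HasDerivAt h (hθ x / x) x := by
    intro x hx
    have hx0 : x ≠ 0 := (hpos x hx).ne'
    have hA0 := (hApos x hx).ne'
    have hG0 := (hGpos x hx).ne'
    have := ((hA x hx).log hA0).sub ((hG x hx).log hG0)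
    refine this.congr_deriv ?_
    simp only [hhθdef]
    field_simp
  set hθ' : ℝ → ℝ := fun x => ((A x * A₂ x - A₁ x ^ 2) / A x ^ 2 - (G x * G₂ x - G₁ x ^ 2) / G x ^ 2) / x with hhθ'def
  have hhθ : ∀ x ∈ Ioo u v, HasDerivAt hθ (hθ' x) x := by
    intro x hx
    have hx0 : x ≠ 0 := (hpos x hx).ne'
    have hA0 := (hApos x hx).ne'
    have hG0 := (hGpos x hx).ne'
    have := ((hA₁ x hx).div (hA x hx) hA0).sub ((hG₁ x hx).div (hG x hx) hG0)
    refine this.congr_deriv ?_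
    simp only [hhθ'def]
    field_simp
  have hθ'_neg : ∀ x ∈ Ioo u v, hθ' x < 0 := by
    intro x hx
    have hxp := hpos x hx
    have hA' := hApos x hx
    have hG' := hGpos x hx
    have h1 : (A x * A₂ x - A₁ x ^ 2) / A x ^ 2 < 0 :=
      div_neg_of_neg_of_pos (by linarith [hlc x hx]) (by positivity)
    have h2 : 0 ≤ (G x * G₂ x - G₁ x ^ 2) / G x ^ 2 :=
      div_nonneg (by linarith [hlx x hx]) (by positivity)
    simp only [hhθ'def]
    exact div_neg_of_neg_of_pos (by linarith) hxp
  -- zeros of `h`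
  have hz : ∀ x ∈ Ioo u v, A x = G x → h x = 0 := by
    intro x hx hAG
    simp only [hhdef, hAG, sub_self]
  -- Rolle twice
  have rolle1 : ∀ {p q : ℝ}, p ∈ Ioo u v → q ∈ Ioo u v → p < q → h p = 0 → h q = 0 → ∃ c ∈ Ioo p q, hθ c = 0 := by
    intro p q hp hq hpq hhp hhq
    have hsub : Icc p q ⊆ Ioo u v := hIc.out hp hq
    have hcont : ContinuousOn h (Icc p q) := fun t ht => (hh t (hsub ht)).continuousAt.continuousWithinAt
    obtain ⟨c, hc, hc'⟩ := exists_hasDerivAt_eq_zero hpq hcont (by rw [hhp, hhq])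
      (fun t ht => hh t (hsub (Ioo_subset_Icc_self ht)))
    have hcI := hsub (Ioo_subset_Icc_self hc)
    exact ⟨c, hc, (div_eq_zero_iff.1 hc').resolve_right (hpos c hcI).ne'⟩
  obtain ⟨c₁, hc₁, hc₁'⟩ := rolle1 h₁ h₂ h12 (hz _ h₁ hz₁) (hz _ h₂ hz₂)
  obtain ⟨c₂, hc₂, hc₂'⟩ := rolle1 h₂ h₃ h23 (hz _ h₂ hz₂) (hz _ h₃ hz₃)
  have hc₁I : c₁ ∈ Ioo u v := ⟨h₁.1.trans hc₁.1, hc₁.2.trans h₂.2⟩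
  have hc₂I : c₂ ∈ Ioo u v := ⟨h₂.1.trans hc₂.1, hc₂.2.trans h₃.2⟩
  have hc12 : c₁ < c₂ := hc₁.2.trans hc₂.1
  have hsub : Icc c₁ c₂ ⊆ Ioo u v := hIc.out hc₁I hc₂I
  have hcont : ContinuousOn hθ (Icc c₁ c₂) := fun t ht => (hhθ t (hsub ht)).continuousAt.continuousWithinAt
  obtain ⟨c, hc, hc'⟩ := exists_hasDerivAt_eq_zero hc12 hcont (by rw [hc₁', hc₂'])
    (fun t ht => hhθ t (hsub (Ioo_subset_Icc_self ht)))
  have hcI := hsub (Ioo_subset_Icc_self hc)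
  exact absurd hc' (hθ'_neg c hcI).ne

end ProductPlusOne

end Summit.ValiantsHypothesis.ValiantsHypothesis.Theorems.LacunarySymmetroidMatrixDescartes
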